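import Summits.QuantumFields.BalabanUV.T4Continuum.Support.NE7MarginalL1Currency
import Summits.QuantumFields.BalabanUV.T4Continuum.Support.NE7MarginalL1Runs
import Summits.QuantumFields.BalabanUV.T4Continuum.Support.NE7MarginalL1Supply
import HarnessLib

/-!
# NE7MarginalL1Assembly — route ℓ¹ of the NE7 crux ASSEMBLED: two IR-pinned runs of (0.20) ⇒ `TailDominated` ∕ `SmearDominated` coupling
# discrepancies ⇒ node U6's Cauchy outputs from `Σσ < ∞`; and the whole ℓ¹ road from ONE-STEP SOURCES: BV one-loop coefficients + summable source
# rates + fading memories + smallness + node U5 ⇒ node U6 — every hypothesis a named tree shape, no rate `θ` anywhere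

Cell `pub-balaban`, rung (B)+1 sub-cell t4, lineage `b2b-balaban-t4-ne7-p1`, generation 28 (CRUX PROVER NE7 #1, ruling e34b3e0c item (2)); route
ℓ¹ = `t4/ROUTES-NE7.md` §L2.1 (rank 1 → t4-ne7-p1; cell C-L1°; PRICING-NE7 v2 §9.5).  Parts: `NE7MarginalL1Currency` (p272763: shapes, A1, A1′,
exactness), `NE7MarginalL1Runs` (A2, A2′: node U2 in ℓ¹ currency), `NE7MarginalL1Supply` (ℓ¹ renewal, sources + memory ⇒ summable shifts, split).
HONEST FRAMING (page 1): FIXED FINITE T⁴, rung (B)+1; NE7 NOT PRINTED in [Balaban1984PropagatorsI]–[Balaban1989LargeFieldII], NOT PROVED here;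
continuum YM on T⁴ ⇐ BetaPertH ∧ nine spine estimates (0/9 proved); BetaPertH ⇐ (D1) ∧ (D4) ∧ CAP+tail; G-an2-4 gates asym, D1 and NE2/3/4;
NOT infinite volume, NOT mass gap, NOT Clay.

WHAT ([folklore] composition BY NAME of the three parts with the tree's `T4CauchySum` §3; 0 def, 0 sorry):
§1 `tailDominated_of_runs_lastOnly` ∕ `smearDominated_of_runs_fadingMemory` — the run-side theorems of `NE7MarginalL1Runs` in the shape language of
   `NE7MarginalL1Currency` (`ShiftAlongRun` ⇒ `TailDominated (exp(2L((k₀+1)γ³+2γ∕b))) σ` under last-only feedback, `SmearDominated 2 ω σ` under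
   `HistLipschitz` + `FadingMemory C ω` + smallness).
§2 **`cauchySum_l1`** ∕ **`cauchySum_smear`** — node U6's four outputs (`T4CauchySum.cauchySum`'s conclusions: `Summable δ`, consecutive generating
   functions `2·vol·δ_K`-close, Cauchy, uniform convergence on `|t| ≤ l₀`) from `TailDominated` ∕ `SmearDominated` + `Summable σ` in place of `InjectedRate`.
§3 **`u6_of_runs_lastOnly`** ∕ **`u6_of_runs_fadingMemory`** — END-TO-END along a family of IR-pinned eventually-AF runs: `ShiftAlongRun σ` along every
   run + `Σσ < ∞` + node U5 (`MatchingModConstants`) ⇒ node U6, in both feedback regimes.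
§4 **`u6_of_sources_fadingMemory`** — THE WHOLE ℓ¹ ROAD FROM ONE-STEP INPUTS: the printed split `β = β⁰ + β¹` (`B12Beta.OneLoopSplit`) with BV one-loop
   coefficients `|β⁰_{k+1} − β⁰_k| ≤ σ⁰_k`, `Σσ⁰ < ∞`; the remainder's `ShiftDecomposition S γ src M s` + `DataRenewal src′ M′ s` with SUMMABLE one-step
   sources `src`, `src′` and memories fading at rate `ω`, `(1+C′)ω < 1`; history moduli `HistLipschitz Λ` with `FadingMemory C ω Λ`;
   `EventualLowerH b γ k₀ β` with `C((k₀+1)γ³ + 2γ∕b) ≤ (1−ω)∕2`; contraction `ρ ∈ [0,1[`; node U5 ⇒ node U6's four outputs.  The marginal channel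
   of the δ-road thus costs, BY NAME: Σ|Δb₀| < ∞ (β-cell), Σ src < ∞ and Σ src′ < ∞ (the η-rows NE2∕NE3∕NE5 — in ℓ¹, not geometric, currency),
   the memories (NE9), the AF window, node U5 (NE7 proper).  HONEST: none of these inputs is printed or proved; this is the δ-road's U2→U6 segment
   (the original spine `T4CauchySum`∕`T4CouplingMatching`), NOT route 1's term-wise END (which consumes `InjectedRate` through `uRateUpTo_of_nodes`;
   re-typing that socket to log-weighted ℓ¹ is the recorded follow-up (27e)); removes no input by name; NE7 NOT proved; NOT summit progress.
-/

noncomputable section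

open Finset Filter Topology

namespace Summit.QuantumFields.BalabanUV.T4Continuum.NE7MarginalL1Assembly

open Literature.MathematicalPhysics.QuantumFieldTheory.Balaban1983to89
open Literature.MathematicalPhysics.QuantumFieldTheory.Balaban1983to89.FlowStep
open T4CauchySum (delta MatchingModConstants genFun genFunLim cauchySeq_genFun tendstoUniformlyOn_genFun abs_genFun_succ_sub_le)
open T4CouplingMatching (disc HistLipschitz FadingMemory LastOnlyLipschitz EventualLowerH)
open T4BetaMemory (ShiftDecomposition DataRenewal)
open NE7MarginalL1Currency NE7MarginalL1Runs NE7MarginalL1Supply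

/-! ## §1 The run-side theorems in the shape language -/

/-- `TailDominated` coupling discrepancies along a family of IR-pinned eventually-AF runs with LAST-ONLY feedback and ℓ¹ shifts along every run
(`NE7MarginalL1Runs.disc_runs_le_tail_lastOnly`, packaged). [folklore] -/
theorem tailDominated_of_runs_lastOnly {β : HBeta} {γ b L : ℝ} {σ : ℕ → ℝ} {k₀ : ℕ} (g : ℕ → ℕ → ℝ) (gIR : ℝ)
    (hγ : 0 < γ) (hb : 0 < b) (hL0 : 0 ≤ L) (hLγ : L * γ ^ 3 ≤ 1 / 2) (hσ0 : ∀ j, 0 ≤ σ j)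
    (hrun : ∀ K, RGEqH K β (g K)) (hbox : ∀ K i, i ≤ K → 0 < g K i ∧ g K i ≤ γ) (hpin : ∀ K, g K K = gIR)
    (hS : ∀ K, ShiftAlongRun σ β (g (K + 1)) K) (hLip : LastOnlyLipschitz L γ β) (hlo : EventualLowerH b γ k₀ β) :
    TailDominated (Real.exp (2 * (L * (((k₀ : ℝ) + 1) * γ ^ 3 + 2 * γ / b)))) σ (fun K j => disc (g K) (g (K + 1)) j) :=
  fun K j hj => disc_runs_le_tail_lastOnly g gIR hγ hb hL0 hLγ hσ0 hrun hbox hpin hS hLip hlo K j hj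

/-- `SmearDominated 2 ω σ` coupling discrepancies along a family of IR-pinned eventually-AF runs under GENUINE FADING MEMORY and ℓ¹ shifts along
every run (`NE7MarginalL1Runs.disc_runs_le_smear_fadingMemory`, packaged). [folklore] -/
theorem smearDominated_of_runs_fadingMemory {β : HBeta} {γ b ω C : ℝ} {Λ : ℕ → ℕ → ℝ} {σ : ℕ → ℝ} {k₀ : ℕ} (g : ℕ → ℕ → ℝ) (gIR : ℝ)
    (hγ : 0 < γ) (hb : 0 < b) (hω0 : 0 < ω) (hω1 : ω < 1) (hC : 0 ≤ C) (hσ0 : ∀ j, 0 ≤ σ j)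
    (hrun : ∀ K, RGEqH K β (g K)) (hbox : ∀ K i, i ≤ K → 0 < g K i ∧ g K i ≤ γ) (hpin : ∀ K, g K K = gIR)
    (hS : ∀ K, ShiftAlongRun σ β (g (K + 1)) K) (hL : HistLipschitz Λ γ β) (hΛ : FadingMemory C ω Λ) (hlo : EventualLowerH b γ k₀ β)
    (hsmall : C * (((k₀ : ℝ) + 1) * γ ^ 3 + 2 * γ / b) ≤ (1 - ω) / 2) :
    SmearDominated 2 ω σ (fun K j => disc (g K) (g (K + 1)) j) :=
  fun K j hj => disc_runs_le_smear_fadingMemory g gIR hγ hb hω0 hω1 hC hσ0 hrun hbox hpin hS hL hΛ hlo hsmall K j hj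

/-! ## §2 Node U6's outputs from ℓ¹ shifts (drop-ins for `T4CauchySum.cauchySum`) -/

/-- **NODE U6 FROM TAIL-DOMINATED (ℓ¹) MARGINAL INJECTIONS** — the four conclusions of `T4CauchySum.cauchySum` with `InjectedRate C c θ` replaced by
`TailDominated M σ` + `Summable σ`.  CONDITIONAL kernel theorem; no hypothesis is in print for Bałaban's d = 4 procedure. [folklore] -/
theorem cauchySum_l1 {E M ρ vol l₀ : ℝ} {σ : ℕ → ℝ} {inj : ℕ → ℕ → ℝ} {Z : ℕ → ℝ → ℝ} (h : TailDominated M σ inj) (hE : 0 ≤ E)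
    (hM : 0 ≤ M) (hσ : ∀ i, 0 ≤ σ i) (hs : Summable σ) (hρ0 : 0 ≤ ρ) (hρ1 : ρ < 1) (hl₀ : 0 ≤ l₀)
    (hU5 : MatchingModConstants vol l₀ (delta E ρ inj) Z) :
    Summable (delta E ρ inj) ∧
    (∀ K : ℕ, ∀ t : ℝ, |t| ≤ l₀ → |genFun Z (K + 1) t - genFun Z K t| ≤ 2 * (vol * delta E ρ inj K)) ∧
    (∀ t : ℝ, |t| ≤ l₀ → CauchySeq fun K => genFun Z K t) ∧
    TendstoUniformlyOn (fun K t => genFun Z K t) (genFunLim Z) atTop {t | |t| ≤ l₀} := by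
  have hδ : Summable (delta E ρ inj) := summable_delta_of_tailDominated h hE hM hσ hs hρ0 hρ1
  exact ⟨hδ, fun K t ht => abs_genFun_succ_sub_le hU5 hl₀ K ht, fun t ht => cauchySeq_genFun hU5 hl₀ hδ ht,
    tendstoUniformlyOn_genFun hU5 hl₀ hδ⟩

/-- **NODE U6 FROM SMEAR-DOMINATED MARGINAL INJECTIONS (fading memory)** — as `cauchySum_l1` with `SmearDominated M ω σ`, `ω ∈ [0,1[`. [folklore] -/
theorem cauchySum_smear {E M ρ ω vol l₀ : ℝ} {σ : ℕ → ℝ} {inj : ℕ → ℕ → ℝ} {Z : ℕ → ℝ → ℝ} (h : SmearDominated M ω σ inj)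
    (hE : 0 ≤ E) (hM : 0 ≤ M) (hσ : ∀ i, 0 ≤ σ i) (hs : Summable σ) (hρ0 : 0 ≤ ρ) (hρ1 : ρ < 1) (hω0 : 0 ≤ ω) (hω1 : ω < 1)
    (hl₀ : 0 ≤ l₀) (hU5 : MatchingModConstants vol l₀ (delta E ρ inj) Z) :
    Summable (delta E ρ inj) ∧
    (∀ K : ℕ, ∀ t : ℝ, |t| ≤ l₀ → |genFun Z (K + 1) t - genFun Z K t| ≤ 2 * (vol * delta E ρ inj K)) ∧
    (∀ t : ℝ, |t| ≤ l₀ → CauchySeq fun K => genFun Z K t) ∧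
    TendstoUniformlyOn (fun K t => genFun Z K t) (genFunLim Z) atTop {t | |t| ≤ l₀} := by
  have hδ : Summable (delta E ρ inj) := summable_delta_of_smearDominated h hE hM hσ hs hρ0 hρ1 hω0 hω1
  exact ⟨hδ, fun K t ht => abs_genFun_succ_sub_le hU5 hl₀ K ht, fun t ht => cauchySeq_genFun hU5 hl₀ hδ ht,
    tendstoUniformlyOn_genFun hU5 hl₀ hδ⟩

/-! ## §3 End to end along a family of runs: `ShiftAlongRun σ` + `Σσ < ∞` + node U5 ⇒ node U6 -/

/-- **U2 → U6 IN ℓ¹ CURRENCY, LAST-ONLY FEEDBACK.**  IR-pinned eventually-AF runs with ℓ¹ shifts along every run, contraction `ρ ∈ [0,1[`, `E ≥ 0`,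
and node U5 for `Z` with the transported coupling discrepancies as remainders ⇒ node U6's four outputs.  Every hypothesis is UNPRINTED.
[folklore] -/
theorem u6_of_runs_lastOnly {β : HBeta} {γ b L E ρ vol l₀ : ℝ} {σ : ℕ → ℝ} {k₀ : ℕ} {Z : ℕ → ℝ → ℝ} (g : ℕ → ℕ → ℝ) (gIR : ℝ)
    (hγ : 0 < γ) (hb : 0 < b) (hL0 : 0 ≤ L) (hLγ : L * γ ^ 3 ≤ 1 / 2) (hσ0 : ∀ j, 0 ≤ σ j) (hs : Summable σ)
    (hrun : ∀ K, RGEqH K β (g K)) (hbox : ∀ K i, i ≤ K → 0 < g K i ∧ g K i ≤ γ) (hpin : ∀ K, g K K = gIR)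
    (hS : ∀ K, ShiftAlongRun σ β (g (K + 1)) K) (hLip : LastOnlyLipschitz L γ β) (hlo : EventualLowerH b γ k₀ β)
    (hE : 0 ≤ E) (hρ0 : 0 ≤ ρ) (hρ1 : ρ < 1) (hl₀ : 0 ≤ l₀)
    (hU5 : MatchingModConstants vol l₀ (delta E ρ (fun K j => disc (g K) (g (K + 1)) j)) Z) :
    Summable (delta E ρ (fun K j => disc (g K) (g (K + 1)) j)) ∧
    (∀ t : ℝ, |t| ≤ l₀ → CauchySeq fun K => genFun Z K t) ∧
    TendstoUniformlyOn (fun K t => genFun Z K t) (genFunLim Z) atTop {t | |t| ≤ l₀} := by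
  have h := cauchySum_l1 (tailDominated_of_runs_lastOnly g gIR hγ hb hL0 hLγ hσ0 hrun hbox hpin hS hLip hlo) hE (Real.exp_pos _).le
    hσ0 hs hρ0 hρ1 hl₀ hU5
  exact ⟨h.1, h.2.2.1, h.2.2.2⟩

/-- **U2 → U6 IN ℓ¹ CURRENCY, GENUINE FADING MEMORY.**  As `u6_of_runs_lastOnly` with history moduli `HistLipschitz Λ`, `FadingMemory C ω Λ`
(`0 < ω < 1`) and the smallness `C((k₀+1)γ³ + 2γ∕b) ≤ (1−ω)∕2`.  Every hypothesis is UNPRINTED. [folklore] -/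
theorem u6_of_runs_fadingMemory {β : HBeta} {γ b ω C E ρ vol l₀ : ℝ} {Λ : ℕ → ℕ → ℝ} {σ : ℕ → ℝ} {k₀ : ℕ} {Z : ℕ → ℝ → ℝ}
    (g : ℕ → ℕ → ℝ) (gIR : ℝ) (hγ : 0 < γ) (hb : 0 < b) (hω0 : 0 < ω) (hω1 : ω < 1) (hC : 0 ≤ C) (hσ0 : ∀ j, 0 ≤ σ j)
    (hs : Summable σ) (hrun : ∀ K, RGEqH K β (g K)) (hbox : ∀ K i, i ≤ K → 0 < g K i ∧ g K i ≤ γ) (hpin : ∀ K, g K K = gIR)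
    (hS : ∀ K, ShiftAlongRun σ β (g (K + 1)) K) (hL : HistLipschitz Λ γ β) (hΛ : FadingMemory C ω Λ) (hlo : EventualLowerH b γ k₀ β)
    (hsmall : C * (((k₀ : ℝ) + 1) * γ ^ 3 + 2 * γ / b) ≤ (1 - ω) / 2)
    (hE : 0 ≤ E) (hρ0 : 0 ≤ ρ) (hρ1 : ρ < 1) (hl₀ : 0 ≤ l₀)
    (hU5 : MatchingModConstants vol l₀ (delta E ρ (fun K j => disc (g K) (g (K + 1)) j)) Z) :
    Summable (delta E ρ (fun K j => disc (g K) (g (K + 1)) j)) ∧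
    (∀ t : ℝ, |t| ≤ l₀ → CauchySeq fun K => genFun Z K t) ∧
    TendstoUniformlyOn (fun K t => genFun Z K t) (genFunLim Z) atTop {t | |t| ≤ l₀} := by
  have h := cauchySum_smear (smearDominated_of_runs_fadingMemory g gIR hγ hb hω0 hω1 hC hσ0 hrun hbox hpin hS hL hΛ hlo hsmall) hE
    (by norm_num) hσ0 hs hρ0 hρ1 hω0.le hω1 hl₀ hU5
  exact ⟨h.1, h.2.2.1, h.2.2.2⟩

/-! ## §4 The whole ℓ¹ road from one-step inputs -/

/-- **THE ℓ¹ ROAD FROM ONE-STEP INPUTS (U2's marginal channel priced by name, no rate anywhere).**  GIVEN: the printed one-loop split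
`S : B12Beta.OneLoopSplit β` with one-loop increments `|β⁰_{k+1} − β⁰_k| ≤ σ⁰_k`, `Σσ⁰ < ∞` (BV of the per-depth one-loop coefficients — the β-cell's
question); the remainder's `ShiftDecomposition S γ src M s` and `DataRenewal src′ M′ s` with nonnegative SUMMABLE one-step sources `src`, `src′`
(the η-rows NE2∕NE3∕NE5, in ℓ¹ currency) and functional memories `FadingMemory C_M ω M`, `FadingMemory C′ ω M′`, `(1 + C′)ω < 1` (NE9-type);
history moduli `HistLipschitz Λ γ β` with `FadingMemory C ω Λ`, `0 < ω < 1`; IR-pinned eventually-AF runs (`EventualLowerH b γ k₀ β`) with the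
smallness `C((k₀+1)γ³ + 2γ∕b) ≤ (1−ω)∕2`; contraction `ρ ∈ [0,1[`, `E ≥ 0`; node U5 for `Z` with the transported coupling discrepancies as
remainders.  THEN node U6's outputs: `Summable δ`, every `K ↦ genFun Z K t` Cauchy, uniform convergence on `|t| ≤ l₀`.  Composition:
`shiftAlong_of_split_l1` ∘ `remainderShift_l1_of_memory` ⇒ `ShiftAlongRun (σ⁰ + σ¹)` summable ⇒ `u6_of_runs_fadingMemory`.  Every hypothesis is
an UNPRINTED input. [folklore] -/
theorem u6_of_sources_fadingMemory {β : HBeta} (S : B12Beta.OneLoopSplit β) {γ b ω C C_M C' E ρ vol l₀ : ℝ} {Λ M M' : ℕ → ℕ → ℝ}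
    {σ0 src src' s : ℕ → ℝ} {k₀ : ℕ} {Z : ℕ → ℝ → ℝ} (g : ℕ → ℕ → ℝ) (gIR : ℝ)
    (hγ : 0 < γ) (hb : 0 < b) (hω0 : 0 < ω) (hω1 : ω < 1) (hC : 0 ≤ C) (hCM : 0 ≤ C_M) (hC' : 0 ≤ C') (hsmallω : (1 + C') * ω < 1)
    (h0 : ∀ k, |S.β0 (k + 1) - S.β0 k| ≤ σ0 k) (hs0 : Summable σ0)
    (hdec : ShiftDecomposition S γ src M s) (hren : DataRenewal src' M' s) (hM : FadingMemory C_M ω M) (hM' : FadingMemory C' ω M')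
    (hs : ∀ i, 0 ≤ s i) (hsrc0 : ∀ k, 0 ≤ src k) (hsrc'0 : ∀ j, 0 ≤ src' j) (hsrc : Summable src) (hsrc' : Summable src')
    (hrun : ∀ K, RGEqH K β (g K)) (hbox : ∀ K i, i ≤ K → 0 < g K i ∧ g K i ≤ γ) (hpin : ∀ K, g K K = gIR)
    (hL : HistLipschitz Λ γ β) (hΛ : FadingMemory C ω Λ) (hlo : EventualLowerH b γ k₀ β)
    (hsmall : C * (((k₀ : ℝ) + 1) * γ ^ 3 + 2 * γ / b) ≤ (1 - ω) / 2)
    (hE : 0 ≤ E) (hρ0 : 0 ≤ ρ) (hρ1 : ρ < 1) (hl₀ : 0 ≤ l₀)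
    (hU5 : MatchingModConstants vol l₀ (delta E ρ (fun K j => disc (g K) (g (K + 1)) j)) Z) :
    Summable (delta E ρ (fun K j => disc (g K) (g (K + 1)) j)) ∧
    (∀ t : ℝ, |t| ≤ l₀ → CauchySeq fun K => genFun Z K t) ∧
    TendstoUniformlyOn (fun K t => genFun Z K t) (genFunLim Z) atTop {t | |t| ≤ l₀} := by
  obtain ⟨hσ1nn, hσ1sum, hσ1box⟩ := remainderShift_l1_of_memory hCM hC' hω0.le hsmallω hdec hren hM hM' hs hsrc0 hsrc'0 hsrc hsrc'
  set σ1 : ℕ → ℝ := fun k => src k + ∑ i ∈ range k, M k i * s i with hσ1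
  have hσ0nn : ∀ j, 0 ≤ σ0 j := fun j => (abs_nonneg _).trans (h0 j)
  have hσnn : ∀ j, 0 ≤ σ0 j + σ1 j := fun j => add_nonneg (hσ0nn j) (hσ1nn j)
  have hσsum : Summable (fun j => σ0 j + σ1 j) := hs0.add hσ1sum
  have hS : ∀ K, ShiftAlongRun (fun j => σ0 j + σ1 j) β (g (K + 1)) K := fun K =>
    (shiftAlong_of_split_l1 S (σ1 := σ1) h0 hσ1box (hbox (K + 1))).1
  exact u6_of_runs_fadingMemory g gIR hγ hb hω0 hω1 hC hσnn hσsum hrun hbox hpin hS hL hΛ hlo hsmall hE hρ0 hρ1 hl₀ hU5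

end Summit.QuantumFields.BalabanUV.T4Continuum.NE7MarginalL1Assembly

end
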